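import Literature.MathematicalPhysics.QuantumLattice.KagomeLattice
import HarnessLib

/-!
# Adjacent kagome sites bisect edges of `𝕋` with a common corner
(discharge of `kagomeEdge_inter_nonempty_of_adj`)

Topic `MathematicalPhysics/QuantumLattice`. Sibling proof file of
`Literature/MathematicalPhysics/QuantumLattice/KagomeLattice.lean` (next to
`KagomeLatticeProofs.lean`, `KagomeLatticeDegreeProofs.lean`, `KagomeLatticeRot60Proofs.lean`):
it **discharges the named fact** `kagomeEdge_inter_nonempty_of_adj` (`def … : Prop`, D-0014) of
that file as
`theorem kagomeEdge_inter_nonempty_of_adj_holds : kagomeEdge_inter_nonempty_of_adj`: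
if two kagome sites `a`, `b` are adjacent in `kagomeGraph`, then the two edges `kagomeEdge a`,
`kagomeEdge b` of the triangular lattice `𝕋` of which they are the midpoints have a common
endpoint (as sets of sites of `ℤ²`). No statement, definition or named fact is introduced or
changed here; the auxiliary declarations are proved lemmas.

## Proof

Direct case analysis on the one-sided adjacency table `KagomeAdjRel ℤ` generating `kagomeGraph`
(`kagomeGraph_adj_iff`; the symmetric case follows from `Set.inter_comm`). By definition
`kagomeEdge (x, 0) = {x, x + e₀}`, `kagomeEdge (x, 1) = {x, x + e₁}`,
`kagomeEdge (x, 2) = {x + e₀, x + e₁}`.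
* Up triangle of the cell `x` (clause `b.1 = a.1 ∧ a.2 ≠ b.2`): the three edges pairwise share a
  corner — `x` (sublattices `0, 1`), `x + e₀` (`0, 2`), `x + e₁` (`1, 2`);
  `kagomeEdge_inter_nonempty_of_ne`.
* Down triangle of the cell `x`: `(x, 2) ∼ (x + e₀, 1)` — `{x + e₀, x + e₁}` and
  `{x + e₀, x + e₀ + e₁}` share `x + e₀`; `(x, 2) ∼ (x + e₁, 0)` — `{x + e₀, x + e₁}` and
  `{x + e₁, x + e₁ + e₀}` share `x + e₁`; `(x, 1) ∼ (x - e₀ + e₁, 0)` — `{x, x + e₁}` and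
  `{x - e₀ + e₁, x + e₁}` share `x + e₁`; `kagomeEdge_inter_nonempty_of_kagomeAdjRel`.

## Sources

L. Savary, L. Balents, *Quantum spin liquids: a review*, Rep. Prog. Phys. **80** (2017) 016502,
doi:10.1088/0034-4885/80/1/016502, arXiv:1601.03742: the kagomé lattice as the lattice of
corner-sharing triangles, §6.4.2 "Kagomé models" and §7.1.1 "Frustration" ("kagomé
(corner-sharing triangles)"), arXiv numbering [cite: SavaryBalents2017, §6.4.2 and §7.1.1]. The
source prints no proof of this elementary lattice-geometry statement (two bonds of a
corner-sharing triangle meet at the shared corner; kagome = medial lattice of `𝕋`); it is proved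
here by direct computation in the coordinates of `KagomeLattice.lean`.
-/

namespace Literature.MathematicalPhysics.QuantumLattice

open Literature.Probability.LatticeModels

/-- The edge of `𝕋` bisected by the kagome site `(x, 0)` is `{x, x + e₀}` (by definition of
`kagomeEdge`). (Savary–Balents 2017, §6.4.2.) [cite: SavaryBalents2017, §6.4.2 and §7.1.1] -/
private theorem kagomeEdge_mk_zero (x : Site 2) :
    kagomeEdge (x, 0) = s(x, x + Pi.single 0 1) := rfl

/-- The edge of `𝕋` bisected by the kagome site `(x, 1)` is `{x, x + e₁}` (by definition of
`kagomeEdge`). (Savary–Balents 2017, §6.4.2.) [cite: SavaryBalents2017, §6.4.2 and §7.1.1] -/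
private theorem kagomeEdge_mk_one (x : Site 2) :
    kagomeEdge (x, 1) = s(x, x + Pi.single 1 1) := rfl

/-- The edge of `𝕋` bisected by the kagome site `(x, 2)` is `{x + e₀, x + e₁}` (by definition of
`kagomeEdge`). (Savary–Balents 2017, §6.4.2.) [cite: SavaryBalents2017, §6.4.2 and §7.1.1] -/
private theorem kagomeEdge_mk_two (x : Site 2) :
    kagomeEdge (x, 2) = s(x + Pi.single 0 1, x + Pi.single 1 1) := rfl

/-- Two unordered pairs of sites with a common element meet, as sets of sites (bookkeeping for
the case analysis below). [folklore] -/
private theorem coe_inter_coe_nonempty {p : Site 2} {e f : Sym2 (Site 2)} (he : p ∈ e)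
    (hf : p ∈ f) : ((e : Set (Site 2)) ∩ (f : Set (Site 2))).Nonempty :=
  ⟨p, Set.mem_inter (SetLike.mem_coe.2 he) (SetLike.mem_coe.2 hf)⟩

/-- Two distinct sites of the up triangle of a cell `x` bisect two edges of `𝕋` with a common
corner: `x` for the sublattices `0, 1`, `x + e₀` for `0, 2`, `x + e₁` for `1, 2`.
(Savary–Balents 2017, §6.4.2, §7.1.1: the kagomé lattice is the lattice of corner-sharing
triangles; proved here by direct computation.) [cite: SavaryBalents2017, §6.4.2 and §7.1.1] -/
theorem kagomeEdge_inter_nonempty_of_ne (x : Site 2) {s t : Fin 3} (hst : s ≠ t) :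
    ((kagomeEdge (x, s) : Set (Site 2)) ∩ (kagomeEdge (x, t) : Set (Site 2))).Nonempty := by
  fin_cases s <;> fin_cases t
  · exact absurd rfl hst
  · -- edges `0`, `1` share the corner `x`
    exact coe_inter_coe_nonempty (Sym2.mem_mk_left x _) (Sym2.mem_mk_left x _)
  · -- edges `0`, `2` share the corner `x + e₀`
    exact coe_inter_coe_nonempty (Sym2.mem_mk_right _ (x + Pi.single 0 1)) (Sym2.mem_mk_left _ _)
  · exact coe_inter_coe_nonempty (Sym2.mem_mk_left x _) (Sym2.mem_mk_left x _)
  · exact absurd rfl hst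
  · -- edges `1`, `2` share the corner `x + e₁`
    exact coe_inter_coe_nonempty (Sym2.mem_mk_right _ (x + Pi.single 1 1)) (Sym2.mem_mk_right _ _)
  · exact coe_inter_coe_nonempty (Sym2.mem_mk_left (x + Pi.single 0 1) _) (Sym2.mem_mk_right _ _)
  · exact coe_inter_coe_nonempty (Sym2.mem_mk_right _ (x + Pi.single 1 1)) (Sym2.mem_mk_right _ _)
  · exact absurd rfl hst

/-- One-sided form of `kagomeEdge_inter_nonempty_of_adj_holds`: if `KagomeAdjRel ℤ a b` then the
edges of `𝕋` bisected by `a` and `b` share a corner (the up-triangle clause by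
`kagomeEdge_inter_nonempty_of_ne`; the three down-triangle bonds `(x, 2) ∼ (x + e₀, 1)`,
`(x, 2) ∼ (x + e₁, 0)`, `(x, 1) ∼ (x - e₀ + e₁, 0)` meet at `x + e₀`, `x + e₁`, `x + e₁`
respectively). (Savary–Balents 2017, §6.4.2, §7.1.1; direct computation.)
[cite: SavaryBalents2017, §6.4.2 and §7.1.1] -/
theorem kagomeEdge_inter_nonempty_of_kagomeAdjRel {a b : KagomeVertex} (h : KagomeAdjRel ℤ a b) :
    ((kagomeEdge a : Set (Site 2)) ∩ (kagomeEdge b : Set (Site 2))).Nonempty := by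
  obtain ⟨x, s⟩ := a
  obtain ⟨y, t⟩ := b
  rcases h with ⟨hxy, hst⟩ | ⟨hs, ht, hxy⟩ | ⟨hs, ht, hxy⟩ | ⟨hs, ht, hxy⟩ <;> dsimp only at hxy
  · -- two sites of the up triangle of one cell
    subst hxy
    exact kagomeEdge_inter_nonempty_of_ne _ hst
  · -- `(x, 2) ∼ (x + e₀, 1)`: `{x + e₀, x + e₁}` and `{x + e₀, x + e₀ + e₁}` share `x + e₀`
    dsimp only at hs ht
    subst hs ht hxy
    rw [kagomeEdge_mk_two, kagomeEdge_mk_one]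
    exact coe_inter_coe_nonempty (Sym2.mem_mk_left _ _) (Sym2.mem_mk_left _ _)
  · -- `(x, 2) ∼ (x + e₁, 0)`: `{x + e₀, x + e₁}` and `{x + e₁, x + e₁ + e₀}` share `x + e₁`
    dsimp only at hs ht
    subst hs ht hxy
    rw [kagomeEdge_mk_two, kagomeEdge_mk_zero]
    exact coe_inter_coe_nonempty (Sym2.mem_mk_right _ _) (Sym2.mem_mk_left _ _)
  · -- `(x, 1) ∼ (x - e₀ + e₁, 0)`: `{x, x + e₁}` and `{x - e₀ + e₁, x + e₁}` share `x + e₁`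
    dsimp only at hs ht
    subst hs ht hxy
    have e : x - Pi.single 0 1 + Pi.single 1 1 + Pi.single 0 1 = x + Pi.single 1 1 := by abel
    rw [kagomeEdge_mk_one, kagomeEdge_mk_zero, e]
    exact coe_inter_coe_nonempty (Sym2.mem_mk_right _ _) (Sym2.mem_mk_right _ _)

/-- **Discharge** of `kagomeEdge_inter_nonempty_of_adj`: two adjacent kagome sites bisect two
edges of the triangular lattice `𝕋` with a common corner (the kagomé lattice is the lattice of
corner-sharing triangles, i.e. the medial lattice of `𝕋`). Proof: `kagomeGraph` is generated by
the symmetrised table `KagomeAdjRel ℤ` (`kagomeGraph_adj_iff`); apply the one-sided form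
`kagomeEdge_inter_nonempty_of_kagomeAdjRel` and the symmetry of `∩`. (Savary–Balents 2017,
§6.4.2 "Kagomé models", §7.1.1 "kagomé (corner-sharing triangles)"; the source prints no proof
of this elementary statement, proved here by direct computation.)
[cite: SavaryBalents2017, §6.4.2 and §7.1.1] -/
theorem kagomeEdge_inter_nonempty_of_adj_holds : kagomeEdge_inter_nonempty_of_adj := by
  intro a b h
  rcases ((kagomeGraph_adj_iff a b).1 h).2 with h | h
  · exact kagomeEdge_inter_nonempty_of_kagomeAdjRel h
  · rw [Set.inter_comm]
    exact kagomeEdge_inter_nonempty_of_kagomeAdjRel h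

end Literature.MathematicalPhysics.QuantumLattice
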